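import Summits.ResolutionOfSingularities.ResolutionOfSingularities.Theorems.FrobeniusLadderFRationalResolutionTowerStep
import Mathlib.Algebra.MonoidAlgebra.Basic
import Mathlib.RingTheory.FiniteType
import HarnessLib

/-!
# Toric surface programme: the `xy`-chart `TA[r,a][x/xy]` of `Bl_{(x,xy)} U(r,a)` inside the torus algebra

Support file for crux stmt-ResolutionOfSingularities-15317 (`FrobeniusLadder.FRationalResolution`), line `redirect`,
lead c4 (toric surface programme for rung 4′: all affine toric surfaces `U(r,a) = Spec k[{m ∈ ℤ² : 0 ≤ m₂, a m₂ ≤ r m₁}]`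
over every field are resolved by the Hirzebruch–Jung tower of two-chart monomial blow-ups).

This file identifies the second chart of the first blow-up of the tower. For the toric surface algebra
`R = TA[r,a] = k[σS[r,a]] ⊆ Lk = k[ℤ²]` (`a < r`), its monomials `x = χ^(1,0)`, `xy = χ^(1,1)`, the centre
`I = (xy, x, x) = (x, xy)` and ANY `R`-algebra isomorphism `e : R[1/xy] ≅ Lk`, the image under `e` of the
affine blow-up algebra `R[I/xy] ⊆ R[1/xy]` is the monomial algebra `k[S₂]`,
`S₂ = {m : 0 ≤ m₁, a m₂ ≤ r m₁} = σS[r,a] + ℕ·(0,−1)`: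

* `blowupAlgebra_span_triple_eq_adjoin` — `R[(b,x,x)/b] = R[x/b]` for any commutative ring (the generator
  `b/b = 1` is superfluous);
* `toric_adjoin_union_yInv` — `k[σS[r,a]][χ^(0,-1)] = k[S₂]` as `k`-subalgebras of `Lk` (a lattice point `m`
  of `S₂` with `m₂ < 0` is `(m₁, 0) + (−m₂)·(0,−1)` with `(m₁, 0) ∈ σS[r,a]`);
* `stub_toric_yChart_carrier` — the chart identification: `e (x/xy) = χ^(1,0) · χ^(−1,−1) = χ^(0,−1)`
  because `e` is an `R`-algebra map and `χ^(1,1)` is a unit of `Lk`, then restriction of scalars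
  (`Algebra.adjoin_union_eq_adjoin_adjoin`).
-/

set_option linter.dupNamespace false

noncomputable section

namespace Summit.ResolutionOfSingularities.ResolutionOfSingularities.Theorems.FRationalResolution

open CategoryTheory AlgebraicGeometry TopologicalSpace
open Literature.AlgebraicGeometry.Resolution

section Toric

variable (k : Type) [Field k]

/-- The Laurent polynomial ring `k[ℤ²]` (coordinate ring of the 2-torus). -/
local notation3 "Lk" => AddMonoidAlgebra k (ℤ × ℤ)

/-- The lattice points of the dual cone `σ∨ = {m₂ ≥ 0, a m₂ ≤ r m₁}` of `σ = cone((0,1),(r,-a))`. -/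
local notation3 "σS[" r ", " a "]" =>
  {m : ℤ × ℤ | 0 ≤ m.2 ∧ ((a : ℕ) : ℤ) * m.2 ≤ ((r : ℕ) : ℤ) * m.1}

/-- The toric surface algebra `k[σ∨ ∩ ℤ²] ⊆ k[ℤ²]`. -/
local notation3 "TA[" r ", " a "]" =>
  Algebra.adjoin k ((fun m : ℤ × ℤ => AddMonoidAlgebra.single m (1 : k)) '' σS[r, a])

/-- `R[(b, x, x)/b] = R[x/b]`: the affine blow-up algebra of the ideal `(b, x, x) = (b, x)` at `b` is generated
over `R` by the single fraction `x/b` (the generator `b/b = 1` is superfluous, and every `i ∈ (b, x)` gives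
`i/b = c + d · (x/b)`). [folklore] -/
theorem blowupAlgebra_span_triple_eq_adjoin {R : Type*} [CommRing R] (x b : R) :
    blowupAlgebra (Ideal.span {b, x, x}) b =
      Algebra.adjoin R {algebraMap R (Localization.Away b) x * IsLocalization.Away.invSelf b} := by
  apply le_antisymm
  · refine Algebra.adjoin_le ?_
    rintro _ ⟨i, hi, rfl⟩
    have hi' : i ∈ Ideal.span {b, x} := by
      have hset : ({b, x, x} : Set R) = {b, x} := by
        rw [Set.pair_eq_singleton]
      rwa [hset] at hi
    obtain ⟨c, d, rfl⟩ := Ideal.mem_span_pair.mp hi'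
    rw [map_add, map_mul, map_mul, add_mul, mul_assoc, IsLocalization.Away.mul_invSelf, mul_one,
      mul_assoc]
    exact Subalgebra.add_mem _ (Subalgebra.algebraMap_mem _ _)
      (Subalgebra.mul_mem _ (Subalgebra.algebraMap_mem _ _) (Algebra.subset_adjoin rfl))
  · refine Algebra.adjoin_le (Set.singleton_subset_iff.mpr ?_)
    exact div_mem_blowupAlgebra _ b (Ideal.subset_span (by simp))

/-- `k[σS[r,a]][y⁻¹] = k[S₂]`: for `1 ≤ r`, the `k`-subalgebra of `Lk` generated by the monomials of
`σS[r,a] = {0 ≤ m₂, a m₂ ≤ r m₁}` together with `y⁻¹ = χ^(0,-1)` is the monomial algebra of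
`S₂ = {0 ≤ m₁, a m₂ ≤ r m₁}`: `σS[r,a] ⊆ S₂` (as `r ≥ 1`), `(0,-1) ∈ S₂`, and conversely a point
`m ∈ S₂` with `m₂ < 0` is `(m₁, 0) + (-m₂) · (0,-1)` with `(m₁, 0) ∈ σS[r,a]`. [folklore] -/
theorem toric_adjoin_union_yInv (r a : ℕ) (hr : 1 ≤ r) :
    Algebra.adjoin k ((fun m : ℤ × ℤ => AddMonoidAlgebra.single m (1 : k)) '' σS[r, a] ∪
        {AddMonoidAlgebra.single ((0 : ℤ), (-1 : ℤ)) 1}) =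
      Algebra.adjoin k ((fun m : ℤ × ℤ => AddMonoidAlgebra.single m (1 : k)) ''
        {m : ℤ × ℤ | 0 ≤ m.1 ∧ ((a : ℕ) : ℤ) * m.2 ≤ ((r : ℕ) : ℤ) * m.1}) := by
  have hr' : (0 : ℤ) < (r : ℤ) := by exact_mod_cast hr
  apply le_antisymm
  · refine Algebra.adjoin_mono (Set.union_subset ?_ ?_)
    · rintro _ ⟨m, ⟨hm2, hm⟩, rfl⟩
      refine ⟨m, ⟨?_, hm⟩, rfl⟩
      have h1 : (0 : ℤ) ≤ (r : ℤ) * m.1 := le_trans (mul_nonneg (Int.natCast_nonneg a) hm2) hm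
      exact nonneg_of_mul_nonneg_right h1 hr'
    · rintro _ rfl
      refine ⟨((0 : ℤ), (-1 : ℤ)), ⟨le_rfl, ?_⟩, rfl⟩
      have ha : (0 : ℤ) ≤ (a : ℤ) := Int.natCast_nonneg a
      linarith
  · refine Algebra.adjoin_le ?_
    rintro _ ⟨⟨m1, m2⟩, ⟨hm1, hm⟩, rfl⟩
    rcases le_or_gt 0 m2 with h2 | h2
    · exact Algebra.subset_adjoin (Or.inl ⟨(m1, m2), ⟨h2, hm⟩, rfl⟩)
    · obtain ⟨n, rfl⟩ : ∃ n : ℕ, m2 = -(n : ℤ) := ⟨m2.natAbs, by omega⟩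
      have hfac : AddMonoidAlgebra.single ((m1, -(n : ℤ)) : ℤ × ℤ) (1 : k) =
          AddMonoidAlgebra.single ((m1, (0 : ℤ)) : ℤ × ℤ) 1 *
            AddMonoidAlgebra.single ((0 : ℤ), (-1 : ℤ)) (1 : k) ^ n := by
        rw [AddMonoidAlgebra.single_pow, AddMonoidAlgebra.single_mul_single, one_pow, mul_one]
        congr 1
        ext <;> simp
      have hm0 : ((m1, (0 : ℤ)) : ℤ × ℤ) ∈ σS[r, a] := by
        refine ⟨le_rfl, ?_⟩
        have : (0 : ℤ) ≤ (r : ℤ) * m1 := mul_nonneg hr'.le hm1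
        simpa using this
      have hym : AddMonoidAlgebra.single ((0 : ℤ), (-1 : ℤ)) (1 : k) ∈
          Algebra.adjoin k ((fun m : ℤ × ℤ => AddMonoidAlgebra.single m (1 : k)) '' σS[r, a] ∪
            {AddMonoidAlgebra.single ((0 : ℤ), (-1 : ℤ)) 1}) :=
        Algebra.subset_adjoin (Set.mem_union_right _ (Set.mem_singleton _))
      have hm0m : AddMonoidAlgebra.single ((m1, (0 : ℤ)) : ℤ × ℤ) (1 : k) ∈
          Algebra.adjoin k ((fun m : ℤ × ℤ => AddMonoidAlgebra.single m (1 : k)) '' σS[r, a] ∪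
            {AddMonoidAlgebra.single ((0 : ℤ), (-1 : ℤ)) 1}) :=
        Algebra.subset_adjoin (Set.mem_union_left _ ⟨(m1, 0), hm0, rfl⟩)
      beta_reduce
      rw [SetLike.mem_coe, hfac]
      exact Subalgebra.mul_mem _ hm0m (Subalgebra.pow_mem _ hym n)

/-- **The `xy`-chart of `Bl_{(x,xy)} U(r,a)` inside the torus algebra.** For `a < r`, the monomials
`x = χ^(1,0)`, `xy = χ^(1,1)` of `TA[r,a]` and ANY `TA[r,a]`-algebra isomorphism `e : TA[r,a][1/xy] ≅ Lk`,
the image of the affine blow-up algebra `TA[r,a][I/xy]`, `I = (xy, x, x)`, is (after restricting scalars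
to `k`) the `k`-subalgebra of `Lk` generated by the monomials of
`{0 ≤ m₁, a m₂ ≤ r m₁} = σS[r,a] + ℕ·(0,−1)`: `TA[r,a][I/xy] = TA[r,a][x/xy]`
(`blowupAlgebra_span_triple_eq_adjoin`),
`e (x/xy) = χ^(1,0) · χ^(−1,−1) = χ^(0,−1)` (`e` commutes with the structure maps and `χ^(1,1)` is a unit
of `Lk`), restriction of scalars (`Algebra.adjoin_union_eq_adjoin_adjoin`) and `toric_adjoin_union_yInv`.
[folklore] -/
theorem stub_toric_yChart_carrier (r a : ℕ) (har : a < r) (x xy : ↥TA[r, a])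
    (hx : (x : Lk) = AddMonoidAlgebra.single ((1 : ℤ), (0 : ℤ)) 1)
    (hxy : (xy : Lk) = AddMonoidAlgebra.single ((1 : ℤ), (1 : ℤ)) 1)
    (e : Localization.Away xy ≃ₐ[↥TA[r, a]] Lk) :
    (Subalgebra.map e.toAlgHom (blowupAlgebra (Ideal.span {xy, x, x}) xy)).restrictScalars k =
      Algebra.adjoin k ((fun m : ℤ × ℤ => AddMonoidAlgebra.single m (1 : k)) ''
        {m : ℤ × ℤ | 0 ≤ m.1 ∧ ((a : ℕ) : ℤ) * m.2 ≤ ((r : ℕ) : ℤ) * m.1}) := by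
  have hr : 1 ≤ r := by omega
  -- `e (1/xy) = χ^(-1,-1)`: apply `e` to `xy/1 · (1/xy) = 1` and use that `χ^(1,1)` is a unit of `Lk`.
  have h1 : (xy : Lk) * e (IsLocalization.Away.invSelf xy) = 1 := by
    have h := congrArg e (IsLocalization.Away.mul_invSelf (S := Localization.Away xy) xy)
    rw [map_mul, map_one, AlgEquiv.commutes] at h
    exact h
  have hunit : AddMonoidAlgebra.single ((-1 : ℤ), (-1 : ℤ)) (1 : k) *
      AddMonoidAlgebra.single ((1 : ℤ), (1 : ℤ)) 1 = 1 := by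
    rw [AddMonoidAlgebra.single_mul_single, AddMonoidAlgebra.one_def, mul_one]
    congr 1
  have he_inv : e (IsLocalization.Away.invSelf xy) =
      AddMonoidAlgebra.single ((-1 : ℤ), (-1 : ℤ)) (1 : k) := by
    rw [hxy] at h1
    calc e (IsLocalization.Away.invSelf xy)
        = AddMonoidAlgebra.single ((-1 : ℤ), (-1 : ℤ)) (1 : k) *
            (AddMonoidAlgebra.single ((1 : ℤ), (1 : ℤ)) 1 * e (IsLocalization.Away.invSelf xy)) := by
          rw [← mul_assoc, hunit, one_mul]
      _ = AddMonoidAlgebra.single ((-1 : ℤ), (-1 : ℤ)) (1 : k) := by rw [h1, mul_one]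
  -- hence `e (x/xy) = χ^(1,0) χ^(-1,-1) = χ^(0,-1) = y⁻¹`
  have hgen : e (algebraMap (↥TA[r, a]) (Localization.Away xy) x * IsLocalization.Away.invSelf xy) =
      AddMonoidAlgebra.single ((0 : ℤ), (-1 : ℤ)) (1 : k) := by
    rw [map_mul, AlgEquiv.commutes, he_inv, Subalgebra.algebraMap_apply, hx,
      AddMonoidAlgebra.single_mul_single, mul_one]
    congr 1
  rw [blowupAlgebra_span_triple_eq_adjoin, AlgHom.map_adjoin_singleton, AlgEquiv.toAlgHom_apply,
    hgen, ← Algebra.adjoin_union_eq_adjoin_adjoin]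
  exact toric_adjoin_union_yInv k r a hr

end Toric

end Summit.ResolutionOfSingularities.ResolutionOfSingularities.Theorems.FRationalResolution

end
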